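import Literature.Barriers.NavierStokesRegularity.SupNormCalderonZygmundWitnesses
import HarnessLib

/-!
# Barrier: no sup-norm Calderón–Zygmund estimate — second derivatives, Helmholtz–Hodge (Leray) components
# and velocity gradients are NOT controlled in `L^∞` by the Laplacian, the field, the vorticity

Barrier catalogue `Literature/Barriers/NavierStokesRegularity/` (D-0021), METHOD LEVEL, everything PROVED
(zero fact debt). Filed by the NS-CLAIMS sweep (D-0090, cell `ns-claims`, seat `ns-claims-salvage-p1`) as the
kernel record of the «endpoint elliptic estimate» failure class: steps that bound a second derivative, a
Hodge/Leray component, a pressure Hessian or a velocity gradient POINTWISE / in sup norm by the sup norm of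
the Laplacian, of the field, or of the vorticity, with a universal constant — i.e. that treat the
order-zero Calderón–Zygmund operators `RⱼRₖ` (`∂ⱼ∂ₖ = −RⱼRₖΔ`, Grafakos 2008 Prop. 5.1.17; Leray projection
`ℙ = Id + ∇(−Δ)⁻¹div = R∧(R∧·)`, Lemarié-Rieusset 2016 Ch. 6 Prop. 6.2; Biot–Savart gradient `∇u = (RᵢRⱼ)ω`)
as bounded on `L^∞`. They are bounded on `L^p`, `1 < p < ∞` (Stein 1970 Ch. III §1.3 Prop. 3; in the tree
at `p = 2` with constant one: `FluidPDE/HessianLaplacian`), from `L^∞` to `BMO`, and on Hölder / Dini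
classes; at the endpoint `p = ∞` they are not, and the honest substitutes carry a LOGARITHM of a higher
norm (Beale–Kato–Majda; Majda–Bertozzi Prop. 3.8 (3.83), Lemma 4.6 (4.35)) — which is exactly what makes
`∫‖ω‖_∞ dt < ∞` a regularity CRITERION (tree `Literature.Analysis.FluidPDE.beale_kato_majda`) and not an
a-priori bound.

## Formal content (namespace `Literature.Barriers.NavierStokesRegularity.SupNormCZ`)

One explicit family does everything: the lacunary harmonic-quadratic sums `u_N = Σ_{k<N} 16^{-k}(χ·x₀x₁)(4^k x)`
of `SupNormCalderonZygmundLacunary.lean` (Gilbarg–Trudinger, Problem 4.9 (a)): `u_N ∈ C_c^∞(ℝ³)`,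
`sup|Δu_N| ≤ M` and every second partial other than `∂₀∂₁` bounded uniformly in `N`, `∂₀∂₁u_N(0) = N`.
* (1) HESSIAN vs LAPLACIAN — `exists_hessian_witness`: `∃ M>0 ∀ K ∃ u ∈ C_c^∞(ℝ³;ℝ)`, `sup|Δu| ≤ M`,
  `∂₀∂₁u(0) ≥ K`, `‖D²u(0)‖ ≥ K`; negations `not_exists_hessian_le_laplacian_sup` (`|∂₀∂₁u| ≤ C sup|Δu|` is
  false for every `C`), `not_exists_norm_iteratedFDeriv_two_le_laplacian_sup`.
* (2) HELMHOLTZ–HODGE / LERAY vs FIELD — `exists_hodge_supNorm_witness`: `∃ M>0 ∀ K ∃ φ, φ₁, φ₂ ∈ C_c^∞(ℝ³;ℝ³)`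
  (hence rapidly decaying, `HasRapidSpatialDecay`), `φ = φ₁ + φ₂`, `div φ₁ = 0`, `curl φ₂ = 0`,
  `sup‖φ‖ ≤ M`, `‖φ₁(0)‖ ≥ K`, `‖φ₂(0)‖ ≥ K` — with `φ = (Δu_N)e₀`, `φ₂ = ∇∂₀u_N`,
  `φ₁ = curl(∂₁u_N e₂ − ∂₂u_N e₁)`; since all three are compactly supported, `(φ₁, φ₂)` IS the (unique
  decaying) Helmholtz–Hodge pair of `φ` and `φ₁ = ℙφ` (Lemarié-Rieusset 2016, Def. 6.4: uniqueness of the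
  curl-free part vanishing at infinity); negations `not_exists_hodge_supNorm_bound` (both parts),
  `not_exists_gradientPart_supNorm_bound`, `not_exists_solenoidalPart_supNorm_bound`.
* (3) VELOCITY GRADIENT vs VORTICITY — `exists_velocity_gradient_witness`: `∃ M>0 ∀ K ∃ U ∈ C_c^∞(ℝ³;ℝ³)`,
  `div U = 0`, `sup‖curl U‖ ≤ M`, `‖DU(0)‖ ≥ K` — with `U = (∂₁u_N, −∂₀u_N, 0) = curl(u_N e₂)`, whose curl
  `(∂₂∂₀u_N, ∂₂∂₁u_N, −∂₀²u_N − ∂₁²u_N)` only contains good directions; negation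
  `not_exists_fderiv_le_curl_sup` (`‖∇U‖_∞ ≤ C‖ω‖_∞` is false on divergence-free `C_c^∞` fields).
* `SupNormCalderonZygmundFailure` (packaged statement, structured barrier block) and `…_holds`.

## Adjudicated instances this entry serves (D-0090 protocol; cite the locator, not the author)

* C09 `Literature.Claims.NS.Liu2025.HodgeSupBound` (implicit glue of the proof of Thm 4.3, print p.29 l.8–9:
  the Hodge components of a Schwartz field bounded in sup norm by `C₀‖φ‖_C`; row #10, first failure upstream
  at `Thm43NullSpaceV0`): pattern (2) refutes it — addendum `…Theorems.Liu2025.not_HodgeSupBound`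
  (refuter-5, importing this file).
* the `L^∞`-scheme family (T1/T7: C20 `Jennings2020` sup-norm non-increase through a Leray-regularised
  equation, C28/C28b sup-norm maximum principles with `u·∇p` terms, C86 `Bledsoe2026` degree miscounts in
  stretching bounds): any step of shape `‖ℙf‖_∞ ≲ ‖f‖_∞`, `‖∇²p‖_∞ ≲ ‖u⊗u‖_∞`, `‖∇u‖_∞ ≲ ‖ω‖_∞` is of the
  class recorded here (patterns (2), (1), (3)); context entries `SupNormGainObstruction` (symbol bounds are
  not sup-norm bounds for SMOOTHING multipliers — the complementary, order-`< 0` half of the same phenomenon),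
  `VortexStretchingAprioriBounds`, `PressureSlaving`.

## References

* D. Gilbarg, N. S. Trudinger (2001), Ch. 4 Problem 4.9 (a) (the construction) and Notes to Ch. 4.
* L. Grafakos, *Classical Fourier Analysis*, 2nd ed. (2008), Prop. 5.1.17 (`∂ⱼ∂ₖφ = −RⱼRₖΔφ`, `φ ∈ 𝒮`),
  Cor. 5.2.8 (`Rⱼ` bounded on `L^p`, `1 < p < ∞`).
* E. M. Stein (1970), Ch. III §1.3 Prop. 3 (`‖∂ⱼ∂ₖf‖_p ≤ A_p‖Δf‖_p`, `1 < p < ∞`).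
* P. G. Lemarié-Rieusset, *The Navier–Stokes Problem in the 21st Century* (2016), Ch. 6, Def. 6.4
  (Leray projection, uniqueness of the decaying curl-free part) and Prop. 6.2 (`ℙ = R∧(R∧·)` on spaces where
  the Riesz transforms act boundedly).
* A. J. Majda, A. L. Bertozzi (2002), Prop. 3.8 (3.83) (`|∇v|_∞ ≤ c(1 + ln⁺‖v‖₃ + ln⁺‖ω‖₀)(1 + |ω|_∞)`),
  §4.1 remark after Thm 4.2 («not valid for the Hölder exponent `γ = 1` … standard property of SIOs»),
  Lemma 4.6 (4.35) (the `ln(R/ε)` term); J. T. Beale, T. Kato, A. Majda (1984) (tree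
  `Literature.Analysis.FluidPDE.beale_kato_majda`).

WHAT THIS IS NOT: not a claim about NS regularity or blow-up; not a claim about any author beyond the typed
locator. Calculus on `ℝ³`; says nothing about solutions of any PDE.
-/

noncomputable section

open Set Filter Topology InnerProductSpace Function Metric
open scoped Laplacian ContDiff RealInnerProductSpace

namespace Literature.Barriers.NavierStokesRegularity.SupNormCZ

open Literature.Analysis.FluidPDE

/-- Local notation for physical space `ℝ³ = EuclideanSpace ℝ (Fin 3)`. -/
local notation "E3" => EuclideanSpace ℝ (Fin 3)

/-! ### (1) The Hessian is not sup-norm controlled by the Laplacian -/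

/-- **No sup-norm Calderón–Zygmund / Schauder estimate at the endpoint**: there is NO constant `C` with
`|∂₀∂₁u(x)| ≤ C · sup|Δu|` for all `u ∈ C_c^∞(ℝ³)` (Stein's `‖∂ⱼ∂ₖf‖_p ≤ A_p‖Δf‖_p` is a `1 < p < ∞`
statement). [cite: GilbargTrudinger2001, Ch. 4 Problem 4.9 (a)] [cite: Stein1971, Ch. III §1.3 Prop. 3] -/
theorem not_exists_hessian_le_laplacian_sup :
    ¬ ∃ C : ℝ, ∀ u : E3 → ℝ, ContDiff ℝ ∞ u → HasCompactSupport u →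
      ∀ M : ℝ, (∀ x, |(Δ u) x| ≤ M) →
        ∀ x, |fderiv ℝ (fun y => fderiv ℝ u y (EuclideanSpace.single 1 1)) x
          (EuclideanSpace.single 0 1)| ≤ C * M := by
  rintro ⟨C, hC⟩
  obtain ⟨M, hM, hw⟩ := exists_hessian_witness
  obtain ⟨u, hu, hc, hΔ, hK, -⟩ := hw (C * M + 1)
  have h := hC u hu hc M hΔ 0
  linarith [le_abs_self (fderiv ℝ (fun y => fderiv ℝ u y (EuclideanSpace.single 1 1)) 0
    (EuclideanSpace.single 0 1))]

/-- Basis-free form: `‖D²u‖_∞ ≤ C · ‖Δu‖_∞` fails on `C_c^∞(ℝ³)` for every `C`.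
[cite: GilbargTrudinger2001, Ch. 4 Problem 4.9 (a)] [cite: Stein1971, Ch. III §1.3 Prop. 3] -/
theorem not_exists_norm_iteratedFDeriv_two_le_laplacian_sup :
    ¬ ∃ C : ℝ, ∀ u : E3 → ℝ, ContDiff ℝ ∞ u → HasCompactSupport u →
      ∀ M : ℝ, (∀ x, |(Δ u) x| ≤ M) → ∀ x, ‖iteratedFDeriv ℝ 2 u x‖ ≤ C * M := by
  rintro ⟨C, hC⟩
  obtain ⟨M, hM, hw⟩ := exists_hessian_witness
  obtain ⟨u, hu, hc, hΔ, -, hK⟩ := hw (C * M + 1)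
  have h := hC u hu hc M hΔ 0
  linarith

/-! ### (3) The velocity gradient is not sup-norm controlled by the vorticity -/

/-- **`‖∇U‖_∞ ≤ C‖curl U‖_∞` is false for divergence-free `C_c^∞` fields** (the log-free
Biot–Savart gradient bound; Majda–Bertozzi: the potential-theory estimate is «not valid for the Hölder
exponent `γ = 1`», a standard property of singular integral operators).
[cite: MajdaBertozziCUP2002, Prop. 3.8 (3.83) and Lemma 4.6 (4.35)] -/
theorem not_exists_fderiv_le_curl_sup :
    ¬ ∃ C : ℝ, ∀ U : E3 → E3, ContDiff ℝ ∞ U → HasCompactSupport U → VectorCalculus.IsDivFree U →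
      ∀ M : ℝ, (∀ x, ‖curl U x‖ ≤ M) → ∀ x, ‖fderiv ℝ U x‖ ≤ C * M := by
  rintro ⟨C, hC⟩
  obtain ⟨M, hM, hw⟩ := exists_velocity_gradient_witness
  obtain ⟨U, hU, hc, hdiv, hcurl, hK⟩ := hw (C * M + 1)
  have h := hC U hU hc hdiv M hcurl 0
  linarith

/-! ### (2) The Helmholtz–Hodge (Leray) components are not sup-norm controlled by the field -/

/-- **The Leray–Helmholtz projection is not bounded on `L^∞` / `C₀`**: no universal `C` bounds BOTH Hodge
components of a `C_c^∞` field in sup norm by the sup norm of the field (the shape of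
`Literature.Claims.NS.Liu2025.HodgeSupBound`, there over Schwartz fields).
[cite: LemarieRieusset2016, Ch. 6 Def. 6.4 and Prop. 6.2] -/
theorem not_exists_hodge_supNorm_bound :
    ¬ ∃ C : ℝ, ∀ φ φ₁ φ₂ : E3 → E3, ContDiff ℝ ∞ φ → ContDiff ℝ ∞ φ₁ → ContDiff ℝ ∞ φ₂ →
      HasCompactSupport φ → HasCompactSupport φ₁ → HasCompactSupport φ₂ →
      (∀ x, φ x = φ₁ x + φ₂ x) → VectorCalculus.IsDivFree φ₁ → (∀ x, curl φ₂ x = 0) →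
      ∀ M : ℝ, (∀ x, ‖φ x‖ ≤ M) → ∀ x, ‖φ₁ x‖ ≤ C * M ∧ ‖φ₂ x‖ ≤ C * M := by
  rintro ⟨C, hC⟩
  obtain ⟨M, hM, hw⟩ := exists_hodge_supNorm_witness
  obtain ⟨φ, φ₁, φ₂, hφ, hφ₁, hφ₂, hcφ, hc₁, hc₂, -, -, -, hsum, hdiv, hcurl, hsup, hK₁, -⟩ :=
    hw (C * M + 1)
  have h := (hC φ φ₁ φ₂ hφ hφ₁ hφ₂ hcφ hc₁ hc₂ hsum hdiv hcurl M hsup 0).1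
  linarith

/-- The same for the gradient part alone (`‖(Id − ℙ)φ‖_∞ ≤ C‖φ‖_∞` fails).
[cite: LemarieRieusset2016, Ch. 6 Def. 6.4 and Prop. 6.2] -/
theorem not_exists_gradientPart_supNorm_bound :
    ¬ ∃ C : ℝ, ∀ φ φ₁ φ₂ : E3 → E3, ContDiff ℝ ∞ φ → ContDiff ℝ ∞ φ₁ → ContDiff ℝ ∞ φ₂ →
      HasCompactSupport φ → HasCompactSupport φ₁ → HasCompactSupport φ₂ →
      (∀ x, φ x = φ₁ x + φ₂ x) → VectorCalculus.IsDivFree φ₁ → (∀ x, curl φ₂ x = 0) →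
      ∀ M : ℝ, (∀ x, ‖φ x‖ ≤ M) → ∀ x, ‖φ₂ x‖ ≤ C * M := by
  rintro ⟨C, hC⟩
  obtain ⟨M, hM, hw⟩ := exists_hodge_supNorm_witness
  obtain ⟨φ, φ₁, φ₂, hφ, hφ₁, hφ₂, hcφ, hc₁, hc₂, -, -, -, hsum, hdiv, hcurl, hsup, -, hK₂⟩ :=
    hw (C * M + 1)
  have h := hC φ φ₁ φ₂ hφ hφ₁ hφ₂ hcφ hc₁ hc₂ hsum hdiv hcurl M hsup 0
  linarith

/-- The same for the solenoidal (Leray) part alone (`‖ℙφ‖_∞ ≤ C‖φ‖_∞` fails).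
[cite: LemarieRieusset2016, Ch. 6 Def. 6.4 and Prop. 6.2] -/
theorem not_exists_solenoidalPart_supNorm_bound :
    ¬ ∃ C : ℝ, ∀ φ φ₁ φ₂ : E3 → E3, ContDiff ℝ ∞ φ → ContDiff ℝ ∞ φ₁ → ContDiff ℝ ∞ φ₂ →
      HasCompactSupport φ → HasCompactSupport φ₁ → HasCompactSupport φ₂ →
      (∀ x, φ x = φ₁ x + φ₂ x) → VectorCalculus.IsDivFree φ₁ → (∀ x, curl φ₂ x = 0) →
      ∀ M : ℝ, (∀ x, ‖φ x‖ ≤ M) → ∀ x, ‖φ₁ x‖ ≤ C * M := by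
  rintro ⟨C, hC⟩
  obtain ⟨M, hM, hw⟩ := exists_hodge_supNorm_witness
  obtain ⟨φ, φ₁, φ₂, hφ, hφ₁, hφ₂, hcφ, hc₁, hc₂, -, -, -, hsum, hdiv, hcurl, hsup, hK₁, -⟩ :=
    hw (C * M + 1)
  have h := hC φ φ₁ φ₂ hφ hφ₁ hφ₂ hcφ hc₁ hc₂ hsum hdiv hcurl M hsup 0
  linarith

/-! ### The packaged barrier statement -/

/-- **Barrier: no sup-norm Calderón–Zygmund estimate** — the conjunction of the three endpoint failures,
each over `C_c^∞(ℝ³)` data and for EVERY constant `C`: (1) `|∂₀∂₁u| ≤ C sup|Δu|`, (2) `‖ℙφ‖_∞, ‖(Id−ℙ)φ‖_∞ ≤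
C‖φ‖_∞` for the (decaying) Helmholtz–Hodge pair, (3) `‖∇U‖_∞ ≤ C sup‖curl U‖` for divergence-free `U`.
technique_class: sup-norm-calderon-zygmund endpoint-elliptic-estimate hessian-by-laplacian-sup
leray-projection-on-Linfty hodge-components-sup-bound pressure-hessian-sup-bound gradient-by-vorticity-sup
bkm-without-log riesz-transform-Linfty schauder-C0-data
blocks: every step for NavierStokesRegularity of the shapes (1) `‖D²u‖_∞ ≲ ‖Δu‖_∞` / `C²` or `C^{1,1}`
regularity from merely BOUNDED (or continuous) Poisson data, incl. pressure-Hessian bounds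
`‖∇²p‖_∞ ≲ ‖u⊗u‖_∞` from `−Δp = ∂ᵢ∂ⱼ(uᵢuⱼ)` [cite: GilbargTrudinger2001, Ch. 4 Problem 4.9 (a)]; (2) sup-norm
bounds for the Helmholtz–Hodge / Leray components of a field by the sup norm of the field, `‖ℙf‖_∞ ≲ ‖f‖_∞`
(the glue `Literature.Claims.NS.Liu2025.HodgeSupBound`, p.29 l.8–9 of that text; `L^∞`/`C₀` maximum-principle
schemes run on the PROJECTED equation) [cite: LemarieRieusset2016, Ch. 6 Def. 6.4 and Prop. 6.2];
(3) `‖∇u‖_∞ ≲ ‖ω‖_∞` without logarithm for divergence-free fields (log-free Biot–Savart gradient bounds, the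
step that would turn `sup|ω|` control into Lipschitz control of particle paths for free)
[cite: MajdaBertozziCUP2002, Prop. 3.8 (3.83) and Lemma 4.6 (4.35)].
because: `∂ⱼ∂ₖ = −RⱼRₖΔ` [cite: Grafakos2008, Prop. 5.1.17], `ℙ = R∧(R∧·)` and `∇ curl⁻¹` are order-zero
Calderón–Zygmund operators: bounded on `L^p`, `1 < p < ∞` [cite: Stein1971, Ch. III §1.3 Prop. 3] (tree, `p = 2`:
`FluidPDE/HessianLaplacian`), NOT on `L^∞` — kernel: the Gilbarg–Trudinger lacunary family
`u_N = Σ_{k<N}16^{-k}(χ·x₀x₁)(4^k x)` (`SupNormCalderonZygmundLacunary`: `sup|Δu_N| ≤ M`, all non-`(0,1)`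
second partials bounded, `∂₀∂₁u_N(0) = N`) and the three witness families built from it here
(`exists_hessian_witness`, `exists_hodge_supNorm_witness`, `exists_velocity_gradient_witness`).
evasions_known: (a) work in `L^p`, `1 < p < ∞`, or in Hölder/Dini classes `C^{0,γ}`, `0 < γ < 1`
(Schauder; Majda–Bertozzi Lemma 4.6 (4.36)), or accept the `BMO`/logarithmic loss — the Beale–Kato–Majda /
Kozono–Taniuchi form `‖∇u‖_∞ ≲ ‖ω‖_∞(1 + log⁺(‖u‖_{H^s}/‖ω‖_∞))` (tree `Literature.Analysis.FluidPDE.beale_kato_majda`),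
which makes `∫‖ω‖_∞dt < ∞` a CRITERION, not a free bound; (b) genuinely one-dimensional / shear / 2½-D
sub-classes where the operators degenerate to the identity (then the claim is about a special data class);
(c) extra structure on the data side (e.g. `Δu ≥ 0`, or frequency localisation at ONE dyadic scale, where
Bernstein gives `‖D²u‖_∞ ≲ ‖Δu‖_∞` with a scale-free constant — but summing over scales costs the log again).
scope_caveats: (i) the witnesses are `C_c^∞` and smooth: the failure is of the CONSTANT, not of
qualitative regularity; (ii) nothing here concerns time evolution, energy, or solutions of any PDE;
(iii) (2) is stated for explicit Hodge pairs with all three fields compactly supported (the Leray projection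
of a general `C_c^∞` field is not compactly supported; uniqueness of the decaying decomposition identifies the
pair, Lemarié-Rieusset Def. 6.4, but that identification is quoted, not re-proved here).
status: established (proved here from the lacunary witness module; standard harmonic analysis)
[cite: GilbargTrudinger2001, Ch. 4 Problem 4.9 (a)] [cite: Stein1971, Ch. III §1.3 Prop. 3]
[cite: Grafakos2008, Prop. 5.1.17] [cite: LemarieRieusset2016, Ch. 6 Def. 6.4 and Prop. 6.2]
[cite: MajdaBertozziCUP2002, Prop. 3.8 (3.83) and Lemma 4.6 (4.35)] -/
def SupNormCalderonZygmundFailure : Prop :=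
  (¬ ∃ C : ℝ, ∀ u : E3 → ℝ, ContDiff ℝ ∞ u → HasCompactSupport u →
      ∀ M : ℝ, (∀ x, |(Δ u) x| ≤ M) →
        ∀ x, |fderiv ℝ (fun y => fderiv ℝ u y (EuclideanSpace.single 1 1)) x
          (EuclideanSpace.single 0 1)| ≤ C * M) ∧
  (¬ ∃ C : ℝ, ∀ φ φ₁ φ₂ : E3 → E3, ContDiff ℝ ∞ φ → ContDiff ℝ ∞ φ₁ → ContDiff ℝ ∞ φ₂ →
      HasCompactSupport φ → HasCompactSupport φ₁ → HasCompactSupport φ₂ →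
      (∀ x, φ x = φ₁ x + φ₂ x) → VectorCalculus.IsDivFree φ₁ → (∀ x, curl φ₂ x = 0) →
      ∀ M : ℝ, (∀ x, ‖φ x‖ ≤ M) → ∀ x, ‖φ₁ x‖ ≤ C * M ∧ ‖φ₂ x‖ ≤ C * M) ∧
  (¬ ∃ C : ℝ, ∀ U : E3 → E3, ContDiff ℝ ∞ U → HasCompactSupport U → VectorCalculus.IsDivFree U →
      ∀ M : ℝ, (∀ x, ‖curl U x‖ ≤ M) → ∀ x, ‖fderiv ℝ U x‖ ≤ C * M)

/-- The barrier `SupNormCalderonZygmundFailure` holds (all three conjuncts proved above).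
[cite: GilbargTrudinger2001, Ch. 4 Problem 4.9 (a)] [cite: Stein1971, Ch. III §1.3 Prop. 3] -/
theorem supNormCalderonZygmundFailure_holds : SupNormCalderonZygmundFailure :=
  ⟨not_exists_hessian_le_laplacian_sup, not_exists_hodge_supNorm_bound, not_exists_fderiv_le_curl_sup⟩

end Literature.Barriers.NavierStokesRegularity.SupNormCZ

end
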